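import Summits.CriticalPhenomena.CardyFormulaZ2.Theorems.CardyComplexConeEdgePrecompactUFRSJunctionGate
import Summits.CriticalPhenomena.CardyFormulaZ2.Theorems.CardyComplexConeEdgePrecompactUFRSJunctionTwoStrandDecay
import Summits.CriticalPhenomena.CardyFormulaZ2.Theorems.CardyComplexConeEdgePrecompactUFRSMarkedDecayRectMono

/-!
# UFRS on rectangles: the per-scale junction bound from the gate, the funnel and the deep case
(line `qkz-strip-boundary-arm` of crux `CardyComplexCone.EdgePrecompact`, stmt-CriticalPhenomena-11387;
assembly of the registered per-scale bound HJ-S = `ufrs_junction_scale_le` (lead c5, wave 3) from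
its three registered inputs; registered anchor `ufrs_junction_scale_le_of_gate`)

**Theorem** (`ufrs_junction_scale_le_of_gate`): S1 → S2 → S0 → HJ-S, where (all registered
sub-goals of stmt-CriticalPhenomena-11387, stated inline and verbatim)
* S1 = `ufrs_junctionGate_prob`: the oriented junction gate `ufrsJunctionGate φ corner N h`
  (`…UFRSJunctionGate.lean`) has probability `≥ c₁ > 0` for `N ≥ N₀`, `h ≤ N`;
* S2 = `ufrs_junctionFunnel`: at a junction `m = medialPoint E.δ e₀` of an admissible rectangle
  datum `E` (or of its translate `shiftData E w`), for a scale `r` such that every marked midpoint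
  of the two data and every corner of the rectangle is within `r/K` of `m` or beyond `K r`, and some
  marked midpoint is beyond `K r`, some oriented gate excludes two corner-disjoint strand-crossings
  of `A(m; r, K r)` (the event `ufrsStrands E w m 2 r (K r)`);
* S0 = `ufrs_junction_deepPair_le`: if all marked midpoints are within `r/K₁` of `z`, already ONE
  strand-crossing of `A(z; r, K₁ r)` has probability `≤ 1/2`;
* HJ-S = `ufrs_junction_scale_le` (verbatim): outside at most `N₀` scale windows `(x/K, K x)`,
  `P(ufrsStrands E w m 2 r (K r)) ≤ 1 - c` for `M η ≤ r`, `K r ≤ R₀`.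

Proof. Constants: `K = max K₁ 16`, `M = K`, `c = min c₁ (1/2)`, `R₀ = min (L/16) R₁` with `L` the
short side, eight windows `X` = the distances from `m` to the (at most four) marked midpoints of
`E` and `shiftData E w` (`finite_markedEdges_W3M`) and to the four corners, `δ₀ ≤ η/(2N₀ + 64)`.
For an admissible scale `r` either some marked midpoint is beyond `K r` — then S2 provides a gate
`G` disjoint from the strand event `S`, so `P(S) + P(G) = P(S ∪ G) ≤ 1` (`S` is measurable,
`measurableSet_ufrsStrands_W3M`) and `P(G) ≥ c₁` by S1 — or all of them are within `r/K ≤ r/K₁`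
(the window dichotomy), and then `S ⊆ ufrsStrands E w m 1 r (K₁ r)` (drop a strand, shrink the
outer radius, `ufrsStrands_mono_radii`) has probability `≤ 1/2 ≤ 1 - c` by S0.

References: H. Kesten, Comm. Math. Phys. 109 (1987), §2; G. Grimmett, *Percolation* (1999), §11.7;
S. Smirnov, C. R. Acad. Sci. Paris 333 (2001), §2.
-/

namespace Summit.CriticalPhenomena.CardyFormulaZ2.Cruxes.EdgePrecompact.QkzStripBoundaryArm

open MeasureTheory Filter Set Metric
open scoped Topology BigOperators Pointwise
open Literature.Probability.LatticeModels Literature.Probability.Percolation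
open Literature.Probability.RandomPlanarGeometry (DobrushinDomain)
open Summit.CriticalPhenomena.CardyFormulaZ2.Theses.CardyComplexCone

noncomputable section

/-- **Two strand-crossings contain one** (keep the first witness). -/
theorem ufrsStrands_one_of_two_HJ (E : DiscreteDobrushin) (w : Site 2) (z : ℂ) (r R : ℝ) :
    ufrsStrands E w z 2 r R ⊆ ufrsStrands E w z 1 r R := by
  intro ω hω
  rw [mem_ufrsStrands_iff] at hω ⊢
  obtain ⟨c, i, j, τ, h, hdis⟩ := hω
  refine ⟨fun a => c (Fin.castLE (by norm_num) a), fun a => i (Fin.castLE (by norm_num) a),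
    fun a => j (Fin.castLE (by norm_num) a), fun a => τ (Fin.castLE (by norm_num) a),
    fun a => h _, fun a b hab => hdis _ _ ?_⟩
  intro heq
  exact hab (Fin.castLE_injective _ heq)

/-- **An event disjoint from a measurable event of probability `≥ c` has probability `≤ 1 - c`.** -/
theorem real_le_one_sub_of_disjoint_HJ {G S : Set (BondConfig (Site 2))} (hS : MeasurableSet S)
    (hGS : Disjoint G S) {c : ℝ} (hc : c ≤ (bondPercolation (zdGraph 2) half).real G) :
    (bondPercolation (zdGraph 2) half).real S ≤ 1 - c := by
  have hu := measureReal_union hGS hS (μ := bondPercolation (zdGraph 2) half)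
  have h1 : (bondPercolation (zdGraph 2) half).real (G ∪ S) ≤ 1 := measureReal_le_one
  linarith

/-- A window `(x/K, K x)` avoided by `r` puts `x` within `r/K` or beyond `K r` (`0 < K`). -/
theorem dichotomy_of_window_HJ {K r x : ℝ} (hK : 0 < K) (h : r ≤ x / K ∨ K * x ≤ r) :
    x ≤ r / K ∨ K * r ≤ x := by
  rcases h with h | h
  · right; rwa [le_div_iff₀ hK, mul_comm] at h
  · left; rw [le_div_iff₀ hK, mul_comm]; exact h

/-- **HJ-S from S1, S2, S0** (registered anchor `ufrs_junction_scale_le_of_gate` of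
stmt-CriticalPhenomena-11387): the per-scale junction bound `ufrs_junction_scale_le`, verbatim,
from the gate probability S1 (`ufrs_junctionGate_prob`), the funnel S2 (`ufrs_junctionFunnel`) and
the deep double-junction bound S0 (`ufrs_junction_deepPair_le`), all stated inline. See the
module docstring for the proof. -/
theorem ufrs_junction_scale_le_of_gate : (∃ c : ℝ, 0 < c ∧ ∃ N₀ : ℕ, ∀ (φ : zdGraph 2 ≃g zdGraph 2) (corner : Bool) (N h : ℕ), N₀ ≤ N → h ≤ N → c ≤ (bondPercolation (zdGraph 2) half).real (ufrsJunctionGate φ corner N h)) → (∀ (N₀ : ℕ) (E : DiscreteDobrushin) (x₀ x₁ y₀ y₁ : ℝ), x₀ < x₁ → y₀ < y₁ → E.Ω = Set.Ioo x₀ x₁ ×ℂ Set.Ioo y₀ y₁ → E.IsZdAdmissible → ∀ (w : Site 2) (η : ℝ), ‖meshPoint E.δ w‖ < η → ∀ e₀ : Sym2 (Site 2), (e₀ ∈ E.zdABEdges ∨ e₀ ∈ (shiftData E w).zdABEdges) → ∀ (r K : ℝ), 16 ≤ K → K * η ≤ r → 64 * E.δ ≤ r → 2 * (N₀ : ℝ)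 * E.δ ≤ r → 16 * (K * r) ≤ min (x₁ - x₀) (y₁ - y₀) → (∀ e : Sym2 (Site 2), (e ∈ E.zdABEdges ∨ e ∈ (shiftData E w).zdABEdges) → dist (medialPoint E.δ e) (medialPoint E.δ e₀) ≤ r / K ∨ K * r ≤ dist (medialPoint E.δ e) (medialPoint E.δ e₀)) → (∃ e : Sym2 (Site 2), (e ∈ E.zdABEdges ∨ e ∈ (shiftData E w).zdABEdges) ∧ K * r ≤ dist (medialPoint E.δ e) (medialPoint E.δ e₀)) → (∀ q : ℂ, (q.re = x₀ ∨ q.re = x₁) → (q.im = y₀ ∨ q.im = y₁) → dist q (medialPoint E.δ e₀) ≤ r / K ∨ K * r ≤ dist q (medialPoint E.δ e₀)) → ∃ (φ : zdGraph 2 ≃g zdGraph 2) (corner : Bool) (N h : ℕ), N₀ ≤ N ∧ h ≤ N ∧ ∀ ω : BondConfig (Site 2), ω ∈ ufrsJunctionGate φ corner N h → ω ∉ ufrsStrands E w (medialPoint E.δ e₀) 2 r (K * r)) → (∀ (D : DobrushinDomain), (∃ x₀ x₁ y₀ y₁ : ℝ, x₀ < x₁ ∧ y₀ < y₁ ∧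 D.carrier = Set.Ioo x₀ x₁ ×ℂ Set.Ioo y₀ y₁) → ∃ (K₁ R₁ : ℝ), 2 ≤ K₁ ∧ 0 < R₁ ∧ ∃ η₀ > (0:ℝ), ∀ η : ℝ, 0 < η → η < η₀ → ∃ δ₀ > (0:ℝ), ∀ E : DiscreteDobrushin, E.Ω = D.carrier → E.IsZdAdmissible → E.δ < δ₀ → ∀ w : Site 2, ‖meshPoint E.δ w‖ < η → ∀ (z : ℂ) (r : ℝ), η ≤ r → K₁ * r ≤ R₁ → (∀ e : Sym2 (Site 2), (e ∈ E.zdABEdges ∨ e ∈ (shiftData E w).zdABEdges) → dist (medialPoint E.δ e) z ≤ r / K₁) → (bondPercolation (zdGraph 2) half).real (ufrsStrands E w z 1 r (K₁ * r)) ≤ 1 / 2) → ∀ (D : DobrushinDomain), (∃ x₀ x₁ y₀ y₁ : ℝ, x₀ < x₁ ∧ y₀ < y₁ ∧ D.carrier = Set.Ioo x₀ x₁ ×ℂ Set.Ioo y₀ y₁) → ∃ (c K M R₀ : ℝ) (N₀ : ℕ), 0 < c ∧ 2 ≤ K ∧ 1 ≤ M ∧ 0 < R₀ ∧ ∃ η₀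 > (0:ℝ), ∀ η : ℝ, 0 < η → η < η₀ → ∃ δ₀ > (0:ℝ), ∀ E : DiscreteDobrushin, E.Ω = D.carrier → E.IsZdAdmissible → E.δ < δ₀ → ∀ w : Site 2, ‖meshPoint E.δ w‖ < η → ∀ e₀ : Sym2 (Site 2), (e₀ ∈ E.zdABEdges ∨ e₀ ∈ (shiftData E w).zdABEdges) → ∃ X : Finset ℝ, X.card ≤ N₀ ∧ ∀ r : ℝ, M * η ≤ r → K * r ≤ R₀ → (∀ x ∈ X, r ≤ x / K ∨ K * x ≤ r) → (bondPercolation (zdGraph 2) half).real (ufrsStrands E w (medialPoint E.δ e₀) 2 r (K * r)) ≤ 1 - c := by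
  intro hS1 hS2 hS0 D hD
  obtain ⟨x₀, x₁, y₀, y₁, hx, hy, hcar⟩ := hD
  obtain ⟨c₁, hc₁, N₀, hgate⟩ := hS1
  obtain ⟨K₁, R₁, hK₁, hR₁, η₁, hη₁, hdeep⟩ := hS0 D ⟨x₀, x₁, y₀, y₁, hx, hy, hcar⟩
  set K : ℝ := max K₁ 16 with hK
  have hK16 : (16 : ℝ) ≤ K := le_max_right _ _
  have hKK₁ : K₁ ≤ K := le_max_left _ _
  have hKpos : 0 < K := by linarith
  set L : ℝ := min (x₁ - x₀) (y₁ - y₀) with hL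
  have hLpos : 0 < L := lt_min (by linarith) (by linarith)
  refine ⟨min c₁ (1 / 2), K, K, min (L / 16) R₁, 8, lt_min hc₁ (by norm_num), by linarith, by linarith,
    lt_min (by positivity) hR₁, η₁, hη₁, fun η hη hηη₁ => ?_⟩
  obtain ⟨δ₁, hδ₁, hdeepη⟩ := hdeep η hη hηη₁
  refine ⟨min δ₁ (η / (2 * N₀ + 64)), lt_min hδ₁ (by positivity), fun E hEΩ hE hδ w hw e₀ he₀ => ?_⟩
  have hEΩ' : E.Ω = Set.Ioo x₀ x₁ ×ℂ Set.Ioo y₀ y₁ := hEΩ.trans hcar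
  have hδpos : 0 < E.δ := hE.delta_pos
  have hδ₁' : E.δ < δ₁ := lt_of_lt_of_le hδ (min_le_left _ _)
  have hδη : (2 * N₀ + 64) * E.δ < η := by
    have h := lt_of_lt_of_le hδ (min_le_right _ _)
    rwa [lt_div_iff₀ (by positivity : (0:ℝ) < 2 * N₀ + 64), mul_comm] at h
  set m : ℂ := medialPoint E.δ e₀ with hm
  -- the windows: distances to the marked midpoints and to the corners
  set T := (finite_markedEdges_W3M hE w).toFinset with hT
  set X : Finset ℝ := T.image (fun e => dist (medialPoint E.δ e) m) ∪
    {dist (⟨x₀, y₀⟩ : ℂ) m, dist (⟨x₀, y₁⟩ : ℂ) m, dist (⟨x₁, y₀⟩ : ℂ) m, dist (⟨x₁, y₁⟩ : ℂ) m} with hX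
  refine ⟨X, ?_, fun r hηr hrR hwin => ?_⟩
  · calc X.card ≤ (T.image (fun e => dist (medialPoint E.δ e) m)).card +
          ({dist (⟨x₀, y₀⟩ : ℂ) m, dist (⟨x₀, y₁⟩ : ℂ) m, dist (⟨x₁, y₀⟩ : ℂ) m, dist (⟨x₁, y₁⟩ : ℂ) m} : Finset ℝ).card :=
          Finset.card_union_le _ _
      _ ≤ 4 + 4 := add_le_add (Finset.card_image_le.trans (card_markedEdges_le_W3M hE w)) Finset.card_le_four
      _ = 8 := by norm_num
  -- bookkeeping of the scale `r`
  have hηr' : η ≤ r := by nlinarith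
  have hrpos : 0 < r := lt_of_lt_of_le hη hηr'
  have hKr : K * r ≤ min (L / 16) R₁ := hrR
  have h16 : 16 * (K * r) ≤ min (x₁ - x₀) (y₁ - y₀) := by
    have := hKr.trans (min_le_left _ _); rw [hL] at this; linarith
  have hK₁r : K₁ * r ≤ R₁ := (mul_le_mul_of_nonneg_right hKK₁ hrpos.le).trans (hKr.trans (min_le_right _ _))
  have h64 : 64 * E.δ ≤ r := by nlinarith
  have hN₀ : 2 * (N₀ : ℝ) * E.δ ≤ r := by
    have : 0 ≤ (N₀ : ℝ) * E.δ := by positivity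
    nlinarith
  -- the dichotomy for the marked midpoints and the corners
  have hdich : ∀ e : Sym2 (Site 2), (e ∈ E.zdABEdges ∨ e ∈ (shiftData E w).zdABEdges) →
      dist (medialPoint E.δ e) m ≤ r / K ∨ K * r ≤ dist (medialPoint E.δ e) m := by
    intro e he
    refine dichotomy_of_window_HJ hKpos (hwin _ ?_)
    rw [hX]
    exact Finset.mem_union_left _ (Finset.mem_image_of_mem _ ((mem_markedEdges_toFinset_W3M hE w e).2 he))
  have hcorner : ∀ q : ℂ, (q.re = x₀ ∨ q.re = x₁) → (q.im = y₀ ∨ q.im = y₁) →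
      dist q m ≤ r / K ∨ K * r ≤ dist q m := by
    intro q hre him
    refine dichotomy_of_window_HJ hKpos (hwin _ ?_)
    rw [hX]
    refine Finset.mem_union_right _ ?_
    have hq : q = (⟨q.re, q.im⟩ : ℂ) := (Complex.eta q).symm
    rcases hre with h1 | h1 <;> rcases him with h2 | h2 <;> rw [hq, h1, h2] <;> simp
  -- the two cases
  by_cases hfar : ∃ e : Sym2 (Site 2), (e ∈ E.zdABEdges ∨ e ∈ (shiftData E w).zdABEdges) ∧ K * r ≤ dist (medialPoint E.δ e) m
  · -- far second junction: gate + funnel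
    obtain ⟨φ, corner, N, h, hN, hh, hfun⟩ := hS2 N₀ E x₀ x₁ y₀ y₁ hx hy hEΩ' hE w η hw e₀ he₀ r K hK16 hηr h64 hN₀
      h16 hdich hfar hcorner
    have hc := hgate φ corner N h hN hh
    have hdisj : Disjoint (ufrsJunctionGate φ corner N h) (ufrsStrands E w m 2 r (K * r)) :=
      Set.disjoint_left.2 fun ω hω hS => hfun ω hω hS
    have := real_le_one_sub_of_disjoint_HJ (measurableSet_ufrsStrands_W3M E w m 2 r (K * r) hδpos) hdisj hc
    linarith [min_le_left c₁ (1 / 2)]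
  · -- deep double junction: one strand suffices
    push Not at hfar
    have hnear : ∀ e : Sym2 (Site 2), (e ∈ E.zdABEdges ∨ e ∈ (shiftData E w).zdABEdges) →
        dist (medialPoint E.δ e) m ≤ r / K₁ := by
      intro e he
      rcases hdich e he with h1 | h1
      · exact h1.trans (div_le_div_of_nonneg_left hrpos.le (by linarith) hKK₁)
      · exact absurd h1 (not_le.2 (hfar e he))
    have h1 := hdeepη E hEΩ hE hδ₁' w hw m r hηr' hK₁r hnear
    have hsub : ufrsStrands E w m 2 r (K * r) ⊆ ufrsStrands E w m 1 r (K₁ * r) :=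
      (ufrsStrands_one_of_two_HJ E w m r (K * r)).trans
        (ufrsStrands_mono_radii le_rfl (mul_le_mul_of_nonneg_right hKK₁ hrpos.le))
    calc (bondPercolation (zdGraph 2) half).real (ufrsStrands E w m 2 r (K * r))
        ≤ (bondPercolation (zdGraph 2) half).real (ufrsStrands E w m 1 r (K₁ * r)) :=
          measureReal_mono hsub (measure_ne_top _ _)
      _ ≤ 1 / 2 := h1
      _ ≤ 1 - min c₁ (1 / 2) := by linarith [min_le_right c₁ (1 / 2)]

end

end Summit.CriticalPhenomena.CardyFormulaZ2.Cruxes.EdgePrecompact.QkzStripBoundaryArm
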